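import Literature.Computability.AlgebraicComplexity.SLOrbitQuotientReynolds
import Literature.Computability.AlgebraicComplexity.SLOrbitQuotientPoints
import Literature.Computability.AlgebraicComplexity.MS08BorelWeilSufficiency
import Literature.RingTheory.IntegralClosure.InjectiveOnPointsBirational
import Literature.RingTheory.IntegralClosure.ConductorTranslates
import HarnessLib

/-!
# The orbit map of a closed `SL`-orbit of forms is a quotient — V: assembly.
# `Grosshans1997_thm_1_11_slOrbit_forms` and `MS08_thm_1_8a` are theorems

Topic `Literature/Computability/AlgebraicComplexity`. Fifth and last file of the discharge programme
for the named fact `Grosshans1997_thm_1_11_slOrbit_forms` («`ℂ[SL_σ(ℂ)]^{G_w} = ℂ[SL_σ(ℂ)·w]` for a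
polystable form `w`», Borel LAG Prop. 6.7 = Grosshans 1997 Thm. 1.11, characteristic `0`), stated in
`SLOrbitMapQuotient.lean`. THEOREMS ONLY (no definition, no new fact).

The printed proof («`π : G → G·x` is a quotient of `G` by `G_x` iff `π` is separable — automatic in
characteristic `0`», via Zariski's Main Theorem and the normality of `G/H`) is followed in the
commutative-algebra form available in Mathlib + the tree:

* `A := ℂ[SL·w] = orbitPullbacks w m ≤ B := ℂ[SL]^{G_w} = rightInvariants w` are finitely generated
  `ℂ`-domains (`SLOrbitQuotientSetup`, `SLOrbitQuotientReynolds.finiteType_rightInvariants` — Hilbert's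
  finiteness theorem for the reductive stabiliser, which is where «`w` polystable» enters through
  Matsushima / Kempf–Ness: after an `SL`-translate the stabiliser is self-adjoint);
* the induced map on maximal ideals is injective (`MaxSpec B` = cosets `gH`,
  `exists_ker_charAt_rightInvariants_eq`; `MaxSpec A` = the closed orbit,
  `SLOrbitQuotientPoints.exists_ker_charAt_orbitPullbacks_eq`; and `ℂ[SL·w]` separates the orbit);
* Zariski's Main Theorem + birationality in characteristic `0`
  (`InjectiveOnPointsBirational.exists_denominators_of_injective_on_maximalIdeals'`) give `r ∈ B`,
  `r(1) ≠ 0`, and `0 ≠ a ∈ A` with `a rʲ ∈ A` and `a rᴺ b ∈ A` for all `b ∈ B`;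
* homogeneity (`SL` moves the denominator off every point of the orbit; the conductor argument
  `ConductorTranslates.le_of_denominators_of_translates` with left translations) gives `B ≤ A`
  (`rightInvariants_le_orbitPullbacks`), first for a form whose stabiliser is closed under `h ↦ hᴴ`,
  then for every polystable form by the Kempf–Ness translate
  (`IsPolystable.exists_translate_stabilizer_star_closed`, `rightInvariants_eq_orbitPullbacks`);
* unfolding gives `Grosshans1997_thm_1_11_slOrbit_forms_holds`, and the consumer edge
  `MS08_thm_1_8a_of_orbitQuotient` of `MS08BorelWeilSufficiency.lean` gives `MS08_thm_1_8a_holds`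
  (Mulmuley–Sohoni, GCT II, Thm. 1.8 (a): for a polystable form `v`, an irreducible rational
  `GL`-module occurs `SL`-equivariantly in `ℂ[SL·v]` iff it is admissible for the stabiliser).

Honest framing: a 1950s theorem of algebraic group theory (and its GCT II corollary) now PROVED in the
tree's special case; bookkeeping for the rows GRO97-A / MS08 1.8(a); nothing here bears on VP versus
VNP, which is NOT proved.

## References

* [Grosshans1997] F. D. Grosshans, *Algebraic Homogeneous Spaces and Invariant Theory*, LNM 1673
  (1997), Thm. 1.11 (quoting Borel, LAG, Prop. 6.7).
* [SpringerLAG1998] T. A. Springer, *Linear Algebraic Groups*, 2nd ed. (1998), 5.3.2 (iii), 5.3.5 (1),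
  5.5.5.
* [KempfNess1979] G. Kempf, L. Ness, *The length of vectors in representation spaces*, LNM 732 (1979),
  Thm. 0.1, 0.2.
* [MulmuleySohoniGCT2SIAM2008] K. Mulmuley, M. Sohoni, *GCT II*, SIAM J. Comput. 38 (2008), Thm. 1.8 (a),
  Prop. 5.2.
* [StacksProject] The Stacks Project, Tag 00Q9 (Zariski's Main Theorem).

## Provenance

Cell `val-lit`, programme #7: architect/assembly val-lit-t02 g7 (files `SLOrbitQuotientSetup`,
`SLOrbitQuotientReynolds`, `InjectiveOnPointsBirational`, this file), points file val-lit-t14 g6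
(`SLOrbitQuotientPoints`), conductor endgame val-lit-x3 g4 (`ConductorTranslates`), birationality
note val-lit-t10 g6.
-/

noncomputable section

open MvPolynomial
open scoped Matrix

namespace Literature.Computability.AlgebraicComplexity

namespace SLOrbitQuotient

variable {σ : Type} [Fintype σ] [DecidableEq σ]

/-! ### § 1 The theorem for a form with self-adjoint stabiliser -/

/-- **`ℂ[SL]^{G_w} ≤ ℂ[SL·w]` for a polystable form `w` of degree `m` whose `SL`-stabiliser is closed
under `h ↦ hᴴ`** (the heart of Grosshans 1997 Thm. 1.11 / Borel LAG Prop. 6.7 in characteristic `0`):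
Zariski's Main Theorem + birationality for `ℂ[SL·w] ⊆ ℂ[SL]^{G_w}` (both finitely generated domains;
injective on maximal ideals because the points of `ℂ[SL]^{G_w}` are cosets and `ℂ[SL·w]` separates
the orbit), then the conductor/homogeneity endgame with left translations.
[cite: Grosshans1997, Thm. 1.11 (proof via Borel LAG 6.7: ZMT, char. 0)] -/
theorem rightInvariants_le_orbitPullbacks {w : MvPolynomial σ ℂ} {m : ℕ} (hw : w.IsHomogeneous m)
    (hst : IsPolystable w)
    (hstar : ∀ h : Matrix σ σ ℂ, h.det = 1 → linSubst σ ℂ h w = w → linSubst σ ℂ hᴴ w = w) :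
    rightInvariants w ≤ orbitPullbacks w m := by
  classical
  have hAB : orbitPullbacks w m ≤ rightInvariants w := orbitPullbacks_le_rightInvariants w m
  -- the two rings `A = ℂ[SL·w] ⊆ B = ℂ[SL]^{G_w}` as an algebra tower over `ℂ`
  letI : Algebra (orbitPullbacks w m) (rightInvariants w) :=
    (Subalgebra.inclusion hAB).toRingHom.toAlgebra
  have halg : ∀ x : orbitPullbacks w m,
      ((algebraMap (orbitPullbacks w m) (rightInvariants w) x : rightInvariants w) :
        Matrix.SpecialLinearGroup σ ℂ → ℂ) = (x : Matrix.SpecialLinearGroup σ ℂ → ℂ) := fun _ => rfl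
  haveI : IsScalarTower ℂ (orbitPullbacks w m) (rightInvariants w) :=
    IsScalarTower.of_algebraMap_eq fun c => rfl
  haveI : IsDomain (orbitPullbacks w m) := isDomain_orbitPullbacks w m
  haveI : IsDomain (rightInvariants w) := isDomain_rightInvariants w
  haveI : Algebra.FiniteType ℂ (orbitPullbacks w m) := by
    rw [← Subalgebra.fg_iff_finiteType]
    exact ⟨Finset.univ.image (orbitFn w m), by
      rw [Finset.coe_image, Finset.coe_univ, Set.image_univ, orbitPullbacks_eq_adjoin]⟩
  haveI : Algebra.FiniteType ℂ (rightInvariants w) := finiteType_rightInvariants hstar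
  have hinj : Function.Injective (algebraMap (orbitPullbacks w m) (rightInvariants w)) :=
    Subalgebra.inclusion_injective hAB
  -- contraction of point-kernels along the inclusion
  have hcomap : ∀ g : Matrix.SpecialLinearGroup σ ℂ,
      (RingHom.ker (charAt (rightInvariants w) g)).comap
          (algebraMap (orbitPullbacks w m) (rightInvariants w)) =
        RingHom.ker (charAt (orbitPullbacks w m) g) := by
    intro g
    ext φ
    simp only [Ideal.mem_comap, RingHom.mem_ker, charAt_apply, halg]
  -- injectivity on maximal ideals: points of `B` are cosets, `A` separates the orbit
  have huniq : ∀ n₁ n₂ : Ideal (rightInvariants w), n₁.IsMaximal → n₂.IsMaximal →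
      n₁.comap (algebraMap (orbitPullbacks w m) (rightInvariants w)) =
        n₂.comap (algebraMap (orbitPullbacks w m) (rightInvariants w)) → n₁ = n₂ := by
    intro n₁ n₂ h₁ h₂ hc
    obtain ⟨g₁, rfl⟩ := exists_ker_charAt_rightInvariants_eq hstar n₁ h₁
    obtain ⟨g₂, rfl⟩ := exists_ker_charAt_rightInvariants_eq hstar n₂ h₂
    rw [hcomap, hcomap] at hc
    exact ker_charAt_rightInvariants_eq_of_linSubst_eq
      (linSubst_eq_of_ker_charAt_orbitPullbacks_eq hw hc)
  -- Zariski's Main Theorem + birationality at the point `1 ∈ SL`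
  haveI hn₀ : (RingHom.ker (charAt (rightInvariants w) 1)).IsMaximal := ker_charAt_isMaximal _ 1
  obtain ⟨r, hr1, a, ha0, hpowj, hb⟩ :=
    Literature.RingTheory.IntegralClosure.InjectiveOnPointsBirational.exists_denominators_of_injective_on_maximalIdeals'
      ℂ hinj huniq (RingHom.ker (charAt (rightInvariants w) 1))
  -- translate the conclusion to functions on `SL`
  have hcoe : ∀ (b : rightInvariants w) (c : orbitPullbacks w m),
      a • b = algebraMap (orbitPullbacks w m) (rightInvariants w) c →
        (a : Matrix.SpecialLinearGroup σ ℂ → ℂ) * (b : Matrix.SpecialLinearGroup σ ℂ → ℂ) =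
          (c : Matrix.SpecialLinearGroup σ ℂ → ℂ) := by
    intro b c h
    rw [Algebra.smul_def] at h
    have h' := congrArg (fun y : rightInvariants w => (y : Matrix.SpecialLinearGroup σ ℂ → ℂ)) h
    simp only [Subalgebra.coe_mul, halg] at h'
    exact h'
  have hAC : ∀ x : orbitPullbacks w m, (x : Matrix.SpecialLinearGroup σ ℂ → ℂ) ∈ coordFns σ :=
    fun x => orbitPullbacks_le_coordFns w m x.2
  have hBC : ∀ x : rightInvariants w, (x : Matrix.SpecialLinearGroup σ ℂ → ℂ) ∈ coordFns σ :=
    fun x => rightInvariants_le_coordFns w x.2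
  have ha_ne : (a : Matrix.SpecialLinearGroup σ ℂ → ℂ) ≠ 0 := fun h => ha0 (Subtype.ext h)
  have hr_ne : (r : Matrix.SpecialLinearGroup σ ℂ → ℂ) ≠ 0 := fun h =>
    hr1 (by rw [RingHom.mem_ker, charAt_apply, h, Pi.zero_apply])
  have har : (a : Matrix.SpecialLinearGroup σ ℂ → ℂ) * (r : Matrix.SpecialLinearGroup σ ℂ → ℂ) ∈
      orbitPullbacks w m := by
    obtain ⟨c₁, hc₁⟩ := hpowj 1
    rw [pow_one] at hc₁
    rw [hcoe r c₁ hc₁]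
    exact c₁.2
  -- the conductor `a·(a·r)` is a non-zero polynomial function, hence non-zero at some `g₀ ∈ SL`
  have hc_ne : (a : Matrix.SpecialLinearGroup σ ℂ → ℂ) *
      ((a : Matrix.SpecialLinearGroup σ ℂ → ℂ) * (r : Matrix.SpecialLinearGroup σ ℂ → ℂ)) ≠ 0 := by
    intro h
    rcases eq_zero_or_eq_zero_of_mul_eq_zero (hAC a) (mul_mem (hAC a) (hBC r)) h with h1 | h1
    · exact ha_ne h1
    · rcases eq_zero_or_eq_zero_of_mul_eq_zero (hAC a) (hBC r) h1 with h2 | h2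
      · exact ha_ne h2
      · exact hr_ne h2
  obtain ⟨g₀, hg₀⟩ : ∃ g₀ : Matrix.SpecialLinearGroup σ ℂ, ((a : Matrix.SpecialLinearGroup σ ℂ → ℂ) *
      ((a : Matrix.SpecialLinearGroup σ ℂ → ℂ) * (r : Matrix.SpecialLinearGroup σ ℂ → ℂ))) g₀ ≠ 0 := by
    obtain ⟨g₀, hg₀⟩ := Function.ne_iff.mp hc_ne
    exact ⟨g₀, hg₀⟩
  -- the conductor/homogeneity endgame with left translations
  refine Literature.RingTheory.IntegralClosure.ConductorTranslates.le_of_denominators_of_translates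
    (A := orbitPullbacks w m) (B := rightInvariants w)
    (fun γ : Matrix.SpecialLinearGroup σ ℂ => leftTranslate γ)
    (fun γ : Matrix.SpecialLinearGroup σ ℂ => leftTranslate γ⁻¹)
    (fun γ x => leftTranslate_leftTranslate_inv γ x)
    (fun γ x hx => leftTranslate_mem_orbitPullbacks γ hx)
    (fun γ x hx => leftTranslate_mem_rightInvariants γ⁻¹ hx) a.2 har ?_ ?_
  · -- `a rᴺ b ∈ A` for every `b ∈ B`
    intro b hbB
    obtain ⟨N, hN⟩ := hb ⟨b, hbB⟩
    obtain ⟨c, hc⟩ := hN N le_rfl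
    refine ⟨N, ?_⟩
    have h1 := hcoe _ c hc
    have h2 : (a : Matrix.SpecialLinearGroup σ ℂ → ℂ) * (r : Matrix.SpecialLinearGroup σ ℂ → ℂ) ^ N * b =
        (c : Matrix.SpecialLinearGroup σ ℂ → ℂ) := by
      rw [mul_assoc, ← h1, Subalgebra.coe_mul, Subalgebra.coe_pow]
    rw [h2]
    exact c.2
  · -- every point of the orbit is missed by some translate of the conductor
    intro 𝔪 h𝔪
    obtain ⟨g, rfl⟩ := exists_ker_charAt_orbitPullbacks_eq hw hst 𝔪 h𝔪
    refine ⟨g * g₀⁻¹, ?_⟩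
    rw [RingHom.mem_ker, charAt_apply]
    change ¬ leftTranslate (g * g₀⁻¹) ((a : Matrix.SpecialLinearGroup σ ℂ → ℂ) *
      ((a : Matrix.SpecialLinearGroup σ ℂ → ℂ) * (r : Matrix.SpecialLinearGroup σ ℂ → ℂ))) g = 0
    rw [leftTranslate_apply, mul_inv_rev, inv_inv, inv_mul_cancel_right]
    exact hg₀

/-! ### § 2 Every polystable form (Kempf–Ness translate) -/

/-- `slEval` of the right-translated polynomial `x ↦ f(x·g₀)` is the right translate of `slEval f`.
[cite: SpringerLAG1998, 2.3.5 (translations of regular functions)] -/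
theorem slEval_linSubst_kronRight (g₀ g : Matrix.SpecialLinearGroup σ ℂ) (f : MvPolynomial (σ × σ) ℂ) :
    slEval (linSubst (σ × σ) ℂ (kronRight (g₀ : Matrix σ σ ℂ)) f) g = slEval f (g * g₀) := by
  rw [slEval_apply, slEval_apply, eval_linSubst_kronRight, Matrix.SpecialLinearGroup.coe_mul]

/-- The stabiliser of `g₀·w` is `g₀ G_w g₀⁻¹`: if `h` fixes `g₀·w` then `g₀⁻¹ h g₀` fixes `w`.
[cite: Grosshans1997, §1 (stabilisers of translates)] -/
theorem linSubst_conj_eq_self {w : MvPolynomial σ ℂ} (g₀ h : Matrix.SpecialLinearGroup σ ℂ)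
    (hh : linSubst σ ℂ (h : Matrix σ σ ℂ) (linSubst σ ℂ (g₀ : Matrix σ σ ℂ) w) =
      linSubst σ ℂ (g₀ : Matrix σ σ ℂ) w) :
    linSubst σ ℂ ((g₀⁻¹ * h * g₀ : Matrix.SpecialLinearGroup σ ℂ) : Matrix σ σ ℂ) w = w := by
  rw [Matrix.SpecialLinearGroup.coe_mul, Matrix.SpecialLinearGroup.coe_mul, linSubst_mul, linSubst_mul,
    AlgHom.comp_apply, AlgHom.comp_apply, hh, ← AlgHom.comp_apply, ← linSubst_mul,
    ← Matrix.SpecialLinearGroup.coe_mul, inv_mul_cancel, Matrix.SpecialLinearGroup.coe_one, linSubst_one,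
    AlgHom.id_apply]

/-- **`ℂ[SL]^{G_w} ≤ ℂ[SL·w]` for every polystable form `w` of degree `m`**: by Kempf–Ness / Matsushima
(`IsPolystable.exists_translate_stabilizer_star_closed`) some `SL`-translate `g₀·w` has a stabiliser
closed under `h ↦ hᴴ`; right translation by `g₀` carries `ℂ[SL]^{G_w}` to `ℂ[SL]^{G_{g₀ w}}` and
`ℂ[SL·w]` to `ℂ[SL·(g₀ w)]`. [cite: Grosshans1997, Thm. 1.11; KempfNess1979, Thm. 0.2] -/
theorem rightInvariants_le_orbitPullbacks_of_isPolystable {w : MvPolynomial σ ℂ} {m : ℕ}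
    (hw : w.IsHomogeneous m) (hst : IsPolystable w) : rightInvariants w ≤ orbitPullbacks w m := by
  intro φ hφ
  obtain ⟨f, rfl⟩ := mem_coordFns_iff.mp hφ.1
  obtain ⟨g₀m, hdet, hstar⟩ := IsPolystable.exists_translate_stabilizer_star_closed (hv := hw) (hst := hst)
  set g₀ : Matrix.SpecialLinearGroup σ ℂ := ⟨g₀m, hdet⟩ with hg₀def
  have hw' : (linSubst σ ℂ (g₀ : Matrix σ σ ℂ) w).IsHomogeneous m := linSubst_isHomogeneous _ hw
  have hst' : IsPolystable (linSubst σ ℂ (g₀ : Matrix σ σ ℂ) w) := hst.of_mem_slOrbit ⟨g₀, rfl⟩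
  have hstar' : ∀ h : Matrix σ σ ℂ, h.det = 1 →
      linSubst σ ℂ h (linSubst σ ℂ (g₀ : Matrix σ σ ℂ) w) = linSubst σ ℂ (g₀ : Matrix σ σ ℂ) w →
      linSubst σ ℂ hᴴ (linSubst σ ℂ (g₀ : Matrix σ σ ℂ) w) = linSubst σ ℂ (g₀ : Matrix σ σ ℂ) w := hstar
  -- the right translate `x ↦ f(x g₀)` is right-invariant under the stabiliser of `g₀·w`
  have hf' : slEval (linSubst (σ × σ) ℂ (kronRight (g₀ : Matrix σ σ ℂ)) f) ∈
      rightInvariants (linSubst σ ℂ (g₀ : Matrix σ σ ℂ) w) := by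
    refine ⟨slEval_mem_coordFns _, fun g h hh => ?_⟩
    rw [slEval_linSubst_kronRight, slEval_linSubst_kronRight]
    have key := hφ.2 (g * g₀) (g₀⁻¹ * h * g₀) (linSubst_conj_eq_self g₀ h hh)
    rw [show g * g₀ * (g₀⁻¹ * h * g₀) = g * h * g₀ by
      simp only [mul_assoc, mul_inv_cancel_left]] at key
    exact key
  -- hence a pull-back along the orbit map of `g₀·w`; translate back
  obtain ⟨F, hF⟩ := mem_orbitPullbacks_iff.mp (rightInvariants_le_orbitPullbacks hw' hst' hstar' hf')
  refine mem_orbitPullbacks_iff.mpr ⟨F, ?_⟩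
  funext x
  have hx := congrFun hF (x * g₀⁻¹)
  rw [slEval_linSubst_kronRight, inv_mul_cancel_right, orbitPullback_apply, ← AlgHom.comp_apply,
    ← linSubst_mul, ← Matrix.SpecialLinearGroup.coe_mul, inv_mul_cancel_right] at hx
  rw [orbitPullback_apply, hx]

/-- **`ℂ[SL_σ(ℂ)]^{G_w} = ℂ[SL_σ(ℂ)·w]`** for a polystable form `w` of degree `m` (the orbit map of the
closed orbit is a quotient of `SL` by the stabiliser), as an equality of subalgebras of the functions on
`SL_σ(ℂ)`. [cite: Grosshans1997, Thm. 1.11 (= Borel LAG Prop. 6.7; char. 0: Springer LAG 5.3.2 (iii), 5.3.5 (1), 5.5.5)] -/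
theorem rightInvariants_eq_orbitPullbacks {w : MvPolynomial σ ℂ} {m : ℕ} (hw : w.IsHomogeneous m)
    (hst : IsPolystable w) : rightInvariants w = orbitPullbacks w m :=
  le_antisymm (rightInvariants_le_orbitPullbacks_of_isPolystable hw hst)
    (orbitPullbacks_le_rightInvariants w m)

end SLOrbitQuotient

/-! ### § 3 The named fact and its GCT II consumer -/

open SLOrbitQuotient in
/-- **Grosshans 1997, Thm. 1.11 / Borel LAG Prop. 6.7 for closed `SL`-orbits of forms — PROVED**: for a
polystable form `w` of degree `m`, every polynomial function on `SL_σ(ℂ)` invariant under right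
translation by the stabiliser of `w` is the pull-back `g ↦ F(g·w)` of a polynomial `F` in the degree-`m`
coefficients. Discharges the named fact `Grosshans1997_thm_1_11_slOrbit_forms` of
`SLOrbitMapQuotient.lean`. [cite: Grosshans1997, Thm. 1.11] -/
theorem Grosshans1997_thm_1_11_slOrbit_forms_holds : Grosshans1997_thm_1_11_slOrbit_forms := by
  intro σ _ _ w m hw hst f hf
  have hφ : slEval f ∈ rightInvariants w := by
    refine ⟨slEval_mem_coordFns f, fun g h hh => ?_⟩
    rw [slEval_apply, slEval_apply, Matrix.SpecialLinearGroup.coe_mul]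
    exact hf _ _ g.2 h.2 hh
  obtain ⟨F, hF⟩ := mem_orbitPullbacks_iff.mp (rightInvariants_le_orbitPullbacks_of_isPolystable hw hst hφ)
  refine ⟨F, fun g hg => ?_⟩
  have key := congrFun hF ⟨g, hg⟩
  rw [orbitPullback_apply, slEval_apply] at key
  exact key.symm

/-- **Mulmuley–Sohoni, GCT II (SIAM J. Comput. 2008), Thm. 1.8 (a) — PROVED**: for a non-zero polystable
form `v` of degree `m > 0` and an irreducible rational `GL_σ(ℂ)`-module `V`, there is a non-zero
`SL`-equivariant map from `V` to some degree piece of the coordinate ring of the orbit of `v` iff `V` is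
admissible for the stabiliser `SL_σ(ℂ) ∩ G_v`. The tree's consumer edge
`MS08_thm_1_8a_of_orbitQuotient` fed with `Grosshans1997_thm_1_11_slOrbit_forms_holds`.
[cite: MulmuleySohoniGCT2SIAM2008, Thm. 1.8 (a) (arXiv cs/0612134 Thm. 2.8 (a))] -/
theorem MS08_thm_1_8a_holds : MS08_thm_1_8a :=
  MS08_thm_1_8a_of_orbitQuotient Grosshans1997_thm_1_11_slOrbit_forms_holds

end Literature.Computability.AlgebraicComplexity

end
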